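import Mathlib
import HarnessLib
import Summits.NavierStokesRegularity.FluidComputer.TriggeredTransferRobust
import Summits.NavierStokesRegularity.FluidComputer.TriggeredTransferBoundedWitness

/-!
# Fluid computer, door N1-FC — the tolerance-robust step WITH A SUP-CEILING: `StepWithinB`, `TransfersWithinB`, and `transfersB_fatten`

Cell `ns-blowup`, seat `ns-blowup-fc-prover-2` (D-0074 GROUP C «bridge support»); completes the square
of door typings of this seat: {exact `Transfers`, tolerance-robust `TransfersWithin`} ×
{no ceiling, sup-ceiling on each piece (`TransfersB`)}. LABEL: E–C typing. WHAT THIS IS NOT: not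
Navier–Stokes evidence — open predicates and implications between them; no scheme instance claimed.

* `TriggerScheme.StepWithinB ν U ε w ρ` — `StepWithin` (hand-over within relative sup-tolerance
  `ρ·λU'` of a zoomed member, slice rapidly decaying) together with a ceiling `‖u t x‖ ≤ M` on the
  slab `[0, T + δ]`; `TransfersWithinB ν ρin ρout` — from every Clay state of the `ρin`-neighbourhood;
* `StepWithinB.stepWithin`, `TransfersWithinB.transfersWithin` (forget the ceiling);
* **`transfersB_fatten : 0 ≤ ρout → ρout ≤ ρin → ρin < c → TransfersWithinB ν ρin ρout →
  (fatten ρin).TransfersB ν`** — the bounded twin of `transfers_fatten`: a tolerance-robust scheme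
  with ceilings IS an exactly transferring scheme with ceilings on the fattened alphabet; combined with
  `exists_boundedRun`, the glued cascade of seat `ns-blowup-fc-prover-1` and
  `BreakdownWitness.navierStokesBreakdownR3_of_bounded` (`TriggeredTransferBoundedWitness`), this is the
  door's route to Fefferman's (C) with ZERO named facts from the DNS-measurable (tolerance-robust,
  bounded) form of the crux: **`navierStokesBreakdownR3_of_transfersWithinB`**,
  **`navierStokesBreakdownR3_of_exists_transfersWithinB`**. [cite: Tao2016AveragedNS, §1.3]

0 sorry; axioms ⊆ {propext, Classical.choice, Quot.sound}.
-/

noncomputable section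

namespace Summit.NavierStokesRegularity.FluidComputer.TriggeredTransfer

open Set MeasureTheory Function
open scoped ENNReal ContDiff NNReal
open Literature.Analysis.FluidPDE
open Literature.Analysis.FluidPDE.FluidComputer (E3 Vel)

namespace TriggerScheme

variable (𝒮 : TriggerScheme)

/-- **One triggered transfer with hand-over tolerance `ρ` AND a sup-ceiling on its piece**: the
clauses of `StepWithin` plus `∃ M, ∀ t ∈ [0, T + δ], ∀ x, ‖u t x‖ ≤ M`. Open; never asserted.
[cite: Tao2016AveragedNS, §1.3] -/
def StepWithinB (ν U ε : ℝ) (w : Vel) (ρ : ℝ) : Prop :=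
  ∃ (T δ : ℝ) (g : ℝ → Vel) (u : ℝ → Vel) (p : ℝ → E3 → ℝ),
    0 < δ ∧ 2 * δ < T ∧ T ≤ 𝒮.Cτ * (1 + |Real.log ε|) ^ 𝒮.q / U ∧
    𝒮.IsTrigger ε δ T g ∧
    IsClassicalNSSolutionOn (Icc 0 (T + δ)) ν g u p ∧ u 0 = w ∧
    (∃ C : ℝ≥0∞, C < ⊤ ∧ ∀ t ∈ Icc 0 (T + δ), ∫⁻ x, ‖u t x‖ₑ ^ 2 ≤ C) ∧
    HasRapidSpatialDecay (u T) ∧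
    (∃ M : ℝ, ∀ t ∈ Icc 0 (T + δ), ∀ x, ‖u t x‖ ≤ M) ∧
    ∃ (U' : ℝ) (w' : Vel) (x₀ : E3), 𝒮.growth * U ≤ U' ∧ w' ∈ 𝒮.F U' ∧ ‖x₀‖ ≤ 𝒮.D ∧
      ∀ x, ‖u T x - zoom 𝒮.lam x₀ w' x‖ ≤ ρ * (𝒮.lam * U')

/-- **The scheme transfers ROBUSTLY WITH CEILINGS** (tolerances `ρin`, `ρout`): from every Clay-class
state within relative sup-distance `ρin·U` of the alphabet, at every amplitude `U ≥ U⋆`, for every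
admissible seed, one bounded triggered transfer with hand-over tolerance `ρout`. Open; never asserted.
[cite: Tao2016AveragedNS, §1.3] -/
def TransfersWithinB (ν ρin ρout : ℝ) : Prop :=
  ∀ U, 𝒮.UStar ≤ U → ∀ v ∈ 𝒮.nbhd ρin U, ∀ ε : ℝ, 0 < ε → ε ≤ 1 → ν * |Real.log ε| ≤ 𝒮.a * U →
    𝒮.StepWithinB ν U ε v ρout

variable {𝒮}

/-- Forgetting the ceiling. [folklore] -/
theorem StepWithinB.stepWithin {ν U ε ρ : ℝ} {w : Vel} (h : 𝒮.StepWithinB ν U ε w ρ) :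
    𝒮.StepWithin ν U ε w ρ := by
  obtain ⟨T, δ, g, u, p, hδ, h2δ, hT, hg, hsol, hu0, hE, hdec, -, U', w', x₀, hgrow, hw', hx₀,
    hclose⟩ := h
  exact ⟨T, δ, g, u, p, hδ, h2δ, hT, hg, hsol, hu0, hE, hdec, U', w', x₀, hgrow, hw', hx₀, hclose⟩

/-- Forgetting the ceilings. [folklore] -/
theorem TransfersWithinB.transfersWithin {ν ρin ρout : ℝ} (h : 𝒮.TransfersWithinB ν ρin ρout) :
    𝒮.TransfersWithin ν ρin ρout :=
  fun U hU v hv ε hε hε1 hadm => (h U hU v hv ε hε hε1 hadm).stepWithin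

/-- **Robust with ceilings ⇒ exact with ceilings on the fattened alphabet** (the bounded twin of
`transfers_fatten`): the robust bounded step from a member `v` of the `ρin`-neighbourhood is, verbatim,
a bounded `Link` of the fattened scheme — same piece, same ceiling — handing over EXACTLY to
`unzoom λ x₀ (u T) ∈ nbhd ρin U'` (`unzoom_mem_nbhd`, `zoom_unzoom`). [folklore] -/
theorem transfersB_fatten {ν ρin ρout : ℝ} (h0 : 0 ≤ ρout) (hio : ρout ≤ ρin) (hρc : ρin < 𝒮.c)
    (hT : 𝒮.TransfersWithinB ν ρin ρout) : (𝒮.fatten ρin (h0.trans hio) hρc).TransfersB ν := by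
  intro U hU v hv ε hε hε1 hadm
  have hU0 : 0 ≤ U := 𝒮.UStar_pos.le.trans hU
  obtain ⟨T, δ, g, u, p, hδ, h2δ, hTlaw, hg, hsol, hu0, hE, hdec, ⟨M, hM⟩, U', w', x₀, hgrow, hw',
    hx₀, hclose⟩ := hT U hU v hv ε hε hε1 hadm
  have hU' : 0 ≤ U' := le_trans (mul_nonneg 𝒮.growth_pos.le hU0) hgrow
  have hTmem : T ∈ Icc 0 (T + δ) := ⟨by linarith, by linarith⟩
  have hmem : unzoom 𝒮.lam x₀ (u T) ∈ 𝒮.nbhd ρin U' :=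
    unzoom_mem_nbhd hio hU' ⟨hsol.contDiff_velocity hTmem, hsol.divFree T hTmem, hdec⟩ hw' hclose
  refine ⟨⟨T, δ, g, u, p, U', unzoom 𝒮.lam x₀ (u T), x₀, hδ, h2δ, hTlaw, isTrigger_fatten _ _ hg,
    hsol, hu0, hE, hgrow, hmem, hx₀, ?_⟩, M, hM⟩
  exact (zoom_unzoom 𝒮.lam_pos.ne' x₀ (u T)).symm

/-- **The bounded calibration.** An exactly transferring scheme with ceilings exists iff a
tolerance-robustly transferring one with ceilings exists (tolerances `0 ≤ ρout ≤ ρin < c`).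
[folklore] -/
theorem exists_transfersB_iff_exists_transfersWithinB (ν : ℝ) :
    (∃ 𝒮 : TriggerScheme, 𝒮.TransfersB ν) ↔
      ∃ (𝒮 : TriggerScheme) (ρin ρout : ℝ),
        0 ≤ ρout ∧ ρout ≤ ρin ∧ ρin < 𝒮.c ∧ 𝒮.TransfersWithinB ν ρin ρout := by
  constructor
  · rintro ⟨𝒮, h⟩
    refine ⟨𝒮, 0, 0, le_rfl, le_rfl, 𝒮.c_pos, fun U hU v hv ε hε hε1 hadm => ?_⟩
    rw [nbhd_zero hU] at hv
    obtain ⟨L, M, hM⟩ := h U hU v hv ε hε hε1 hadm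
    have hclay := 𝒮.clay L.U' (L.UStar_le_U' hU) L.w' L.mem
    have hzoom : L.u L.T = zoom 𝒮.lam L.x₀ L.w' := by rw [L.handover]; rfl
    refine ⟨L.T, L.δ, L.g, L.u, L.p, L.δ_pos, L.two_δ_lt, L.T_le, L.trigger, L.classical, L.initial,
      L.energy, ?_, ⟨M, hM⟩, L.U', L.w', L.x₀, L.growth_le, L.mem, L.norm_x₀_le, fun x => ?_⟩
    · rw [hzoom]
      exact hasRapidSpatialDecay_zoom hclay.1 hclay.2.2 𝒮.lam_pos _
    · rw [hzoom, sub_self, norm_zero, zero_mul]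
  · rintro ⟨𝒮, ρin, ρout, h0, hio, hρc, h⟩
    exact ⟨𝒮.fatten ρin (h0.trans hio) hρc, transfersB_fatten h0 hio hρc h⟩

/-! ## The robust bounded door closes on (C) with zero named facts -/

/-- **(C) from the tolerance-robust bounded crux at one viscosity** (`transfersB_fatten`, then
`navierStokesBreakdownR3_of_transfersB` on the fattened scheme): no Literature hypothesis.
HONEST FRAMING: the hypothesis is open physics, asserted nowhere. [cite: FeffermanClay2006, (C)] -/
theorem navierStokesBreakdownR3_of_transfersWithinB {ν ρin ρout : ℝ} (hν : 0 < ν) (h0 : 0 ≤ ρout)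
    (hio : ρout ≤ ρin) (hρc : ρin < 𝒮.c) (hT : 𝒮.TransfersWithinB ν ρin ρout) :
    Summit.NavierStokesRegularity.NavierStokesRegularity.NavierStokesBreakdownR3 :=
  (𝒮.fatten ρin (h0.trans hio) hρc).navierStokesBreakdownR3_of_transfersB hν
    (transfersB_fatten h0 hio hρc hT)

/-- **The route's words, robust form**: a scheme transferring robustly with ceilings at unit viscosity
(tolerances `0 ≤ ρout ≤ ρin < c` — output error no larger than input tolerance, Tao's no-accumulation)
implies `NavierStokesBreakdownR3`; ONE physical crux, NO Literature hypothesis.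
[cite: FeffermanClay2006, (C)] -/
theorem navierStokesBreakdownR3_of_exists_transfersWithinB
    (h : ∃ (𝒮 : TriggerScheme) (ρin ρout : ℝ),
      0 ≤ ρout ∧ ρout ≤ ρin ∧ ρin < 𝒮.c ∧ 𝒮.TransfersWithinB 1 ρin ρout) :
    Summit.NavierStokesRegularity.NavierStokesRegularity.NavierStokesBreakdownR3 := by
  obtain ⟨𝒮, ρin, ρout, h0, hio, hρc, hT⟩ := h
  exact navierStokesBreakdownR3_of_transfersWithinB one_pos h0 hio hρc hT

/-- **Robust transfer with ceilings and an AFFINE ERROR BUDGET** (`amp`, `leak`: the spec-sheet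
keys in sup-norm units): for every input tolerance `0 ≤ ρ < c`, `TransfersWithinB ν ρ (amp·ρ + leak)`.
The bounded twin of `TransfersWithBudget`; open, never asserted. [cite: Tao2016AveragedNS, §1.3] -/
def TransfersWithBudgetB (𝒮 : TriggerScheme) (ν amp leak : ℝ) : Prop :=
  ∀ ρ, 0 ≤ ρ → ρ < 𝒮.c → 𝒮.TransfersWithinB ν ρ (amp * ρ + leak)

/-- **(C) from a closing error budget with ceilings** — `amp·ρ + leak ≤ ρ < c` (the sup-norm twin of
`GadgetSpec.Closure`): no Literature hypothesis. [cite: FeffermanClay2006, (C)] -/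
theorem navierStokesBreakdownR3_of_budgetB {ν amp leak ρ : ℝ} (hν : 0 < ν) (hamp : 0 ≤ amp)
    (hleak : 0 ≤ leak) (hρ0 : 0 ≤ ρ) (hρc : ρ < 𝒮.c) (hclos : amp * ρ + leak ≤ ρ)
    (h : 𝒮.TransfersWithBudgetB ν amp leak) :
    Summit.NavierStokesRegularity.NavierStokesRegularity.NavierStokesBreakdownR3 :=
  navierStokesBreakdownR3_of_transfersWithinB hν (by positivity) hclos hρc (h ρ hρ0 hρc)

end TriggerScheme

end Summit.NavierStokesRegularity.FluidComputer.TriggeredTransfer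

end
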